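import Literature.AlgebraicGeometry.Motives.CurveThroughTwoPointsProofs
import Literature.AlgebraicGeometry.Motives.VarietiesGeometricallyIntegralProofs
import Literature.AlgebraicGeometry.Motives.JacobianHomology
import Literature.AlgebraicGeometry.Motives.ComplexPointsEhresmann
import Literature.AlgebraicGeometry.Resolution.QuasiProjectiveChowCover
import Literature.NumberTheory.Transcendental.Analytification
import HarnessLib

/-!
# Two points of an irreducible variety lie on an irreducible curve (Mumford) — separated bases

Topic `Literature/AlgebraicGeometry/Motives` (family `hodge`). PROOF FILE (theorems only; no definition,
no named fact). Companion of `Motives/CurveThroughTwoPoints` (the named fact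
`mumford_smoothCurve_through_two_points`, Mumford, *Abelian Varieties*, §6, Lemma, in the normalised
smooth-affine-curve form over `ℂ`, stated there for AFFINE ambient schemes only and PROVED in
`Motives/CurveThroughTwoPointsProofs`) which records under "What is NOT here" the general printed form:
"Any two points of an irreducible variety `X` lie on an irreducible curve `C` on `X`" — `X` a variety,
i.e. SEPARATED of finite type, not necessarily affine. Mumford's printed proof begins "By Chow's lemma we
may assume `X` projective"; the tree now PROVES Chow's lemma in the integral form of Görtz–Wedhorn
Thm. 13.100 (`Resolution.ChowLemmaIntegral_holds`, `Resolution/ChowLemmaProofs`) and that finitely many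
points of a scheme immersed in `ℙⁿ_k` lie in a common affine open
(`Resolution.exists_isAffineOpen_finset_subset_of_isImmersion`, Liu Prop. 3.3.36 (b),
`Resolution/QuasiProjectiveChowCover`), so the separated case follows from the affine one:

* `mumford_smoothCurve_through_two_points_of_isSeparated_of_quasiCompact` — for an INTEGRAL SEPARATED
  quasi-compact `ℂ`-scheme `S` locally of finite type (an irreducible complex variety) and complex points
  `a ≠ b` of `S`, there are a smooth irreducible affine curve `C`, a `ℂ`-morphism `g : C ⟶ S` and complex
  points `a'`, `b'` of `C` over `a`, `b`. Proof: Chow cover `π : X' → S` (`X'` integral, immersed in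
  `ℙⁿ_ℂ`, `π` proper surjective); lift `a`, `b` to complex points `x₁ ≠ x₀` of `X'`
  (`AlgPoints.map_surjective_of_surjective`); an affine open `U ⊆ X'` through both; the affine case
  (`mumford_smoothCurve_through_two_points_holds`) in the integral affine `U`; compose with `U ↪ X' → S`.
* `mumford_smoothCurve_through_two_points_of_isSeparated` — the same WITHOUT quasi-compactness
  (restrict first to the union of two affine opens through `a` and `b`).
* `mumford_smoothCurve_through_two_points_of_isSeparated_of_smooth` — the case of a smooth irreducible
  separated `ℂ`-scheme (smooth over a field ⇒ reduced, `isReduced_of_smooth_over_field`), the form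
  consumed by base-change arguments over smooth bases (variational Hodge conjecture reductions,
  Mumford–Tate families: `Summits/HodgeConjecture/…/Ring2HypothesesMTAnchors*`).

What is still NOT here: non-separated irreducible ambient schemes (the printed lemma is about varieties);
the conclusion as an irreducible closed curve `D ⊆ X` (only the normalised form: a smooth affine
irreducible curve mapping to `X` through the two points); a closed irreducible `Z ⊊ S` in place of `S`
(give `Z` its reduced structure and apply the theorem to `Z`); other algebraically closed fields.

## References

* [MumfordAV1970] D. Mumford, Abelian Varieties, TIFR Studies in Math. 5, OUP 1970, §6, Lemma ("Any two
  points of an irreducible variety lie on an irreducible curve"; proof: "By Chow's lemma we may assume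
  `X` projective").
* [GortzWedhorn2020] U. Görtz, T. Wedhorn, Algebraic Geometry I, 2nd ed. 2020, Thm. 13.100 (Chow's lemma).
* [Liu2002] Q. Liu, Algebraic Geometry and Arithmetic Curves, OUP 2002, Prop. 3.3.36 (b).
-/

noncomputable section

open CategoryTheory AlgebraicGeometry

namespace Literature.AlgebraicGeometry.Motives

/-- An open subscheme of an integral scheme through a point is integral (Mathlib
`isIntegral_of_isOpenImmersion`). [folklore] -/
private theorem isIntegral_openSubschemeOver_of_mem {S : SchemeOver ℂ} [IsIntegral S.left] (U : S.left.Opens)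
    {x : S.left} (hx : x ∈ U) : IsIntegral (openSubschemeOver S U).left :=
  haveI : Nonempty (U : Scheme) := ⟨(⟨x, hx⟩ : U)⟩
  show IsIntegral (U : Scheme) from isIntegral_of_isOpenImmersion U.ι

/-- A complex point of `X` whose underlying point lies in the open `U ⊆ X` lifts to a complex point of
the open subscheme `U` (`AlgPoints.liftOfMemOpensRange`). [folklore] -/
private theorem exists_map_openSubschemeOverι_eq {X : SchemeOver ℂ} (U : X.left.Opens) (P : ComplexPoints X)
    (hP : P.pt ∈ U) : ∃ Q : ComplexPoints (openSubschemeOver X U), AlgPoints.map (openSubschemeOverι X U) Q = P := by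
  haveI : IsOpenImmersion (openSubschemeOverι X U).left := inferInstanceAs (IsOpenImmersion U.ι)
  have hP' : P.pt ∈ (openSubschemeOverι X U).left.opensRange := by
    change P.pt ∈ U.ι.opensRange
    rwa [Scheme.Opens.opensRange_ι]
  exact ⟨AlgPoints.liftOfMemOpensRange _ P hP', AlgPoints.map_liftOfMemOpensRange _ P hP'⟩

/-- **Mumford's two-point lemma for irreducible varieties (separated, quasi-compact form).** For an
integral separated quasi-compact `ℂ`-scheme `S` locally of finite type and two DISTINCT complex points
`a ≠ b` of `S`, there are a smooth irreducible affine `ℂ`-scheme `C` of topological Krull dimension `1`,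
a `ℂ`-morphism `g : C ⟶ S`, and complex points `a'`, `b'` of `C` with `g a' = a`, `g b' = b`. Proof as
in print ("By Chow's lemma we may assume `X` projective"): a Chow cover `π : X' → S` with `X'` integral
and immersed in `ℙⁿ_ℂ` (`Resolution.ChowLemmaIntegral_holds`), lifts `x₁ ≠ x₀` of `a`, `b` (`π` is
surjective on complex points), an affine open of `X'` through both
(`Resolution.exists_isAffineOpen_finset_subset_of_isImmersion`), and the affine case
(`mumford_smoothCurve_through_two_points_holds`). [cite: MumfordAV1970, §6, Lemma]
[cite: GortzWedhorn2020, Thm. 13.100] [cite: Liu2002, Prop. 3.3.36 (b)] -/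
theorem mumford_smoothCurve_through_two_points_of_isSeparated_of_quasiCompact {S : SchemeOver ℂ}
    [IsIntegral S.left] [IsSeparated S.hom] [QuasiCompact S.hom] [LocallyOfFiniteType S.hom]
    (a b : ComplexPoints S) (hab : a ≠ b) :
    ∃ (C : SchemeOver ℂ) (g : C ⟶ S) (a' b' : ComplexPoints C),
      IsAffine C.left ∧ IrreducibleSpace C.left ∧ AlgebraicGeometry.Smooth C.hom ∧
        topologicalKrullDim C.left = 1 ∧ AlgPoints.map g a' = a ∧ AlgPoints.map g b' = b := by
  classical
  -- Chow's lemma, integral form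
  obtain ⟨n, X', π, ι, hint', hι, hπ, hsurj, -, -⟩ :=
    Resolution.ChowLemmaIntegral_holds ℂ S.left S.hom inferInstance inferInstance inferInstance
      inferInstance
  haveI := hint'
  haveI := hι
  haveI := hπ
  let X'o : SchemeOver ℂ := Over.mk (π ≫ S.hom)
  let πo : X'o ⟶ S := Over.homMk π rfl
  haveI : LocallyOfFiniteType X'o.hom := by
    change LocallyOfFiniteType (π ≫ S.hom)
    infer_instance
  haveI : Surjective πo.left := hsurj
  haveI : IsIntegral X'o.left := hint'
  -- lift the two points
  obtain ⟨x₁, hx₁⟩ := AlgPoints.map_surjective_of_surjective πo a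
  obtain ⟨x₀, hx₀⟩ := AlgPoints.map_surjective_of_surjective πo b
  have hx : x₁ ≠ x₀ := fun h => hab (by rw [← hx₁, ← hx₀, h])
  -- an affine open of `X'` through both lifts
  obtain ⟨U, hU, hsub⟩ :=
    Resolution.exists_isAffineOpen_finset_subset_of_isImmersion ι ({x₁.pt, x₀.pt} : Finset X')
  have h₁U : x₁.pt ∈ U := hsub (Finset.mem_coe.mpr (Finset.mem_insert_self _ _))
  have h₀U : x₀.pt ∈ U :=
    hsub (Finset.mem_coe.mpr (Finset.mem_insert_of_mem (Finset.mem_singleton_self _)))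
  haveI : IsAffine (openSubschemeOver X'o U).left := hU
  haveI : LocallyOfFiniteType (openSubschemeOver X'o U).hom := by
    change LocallyOfFiniteType (U.ι ≫ π ≫ S.hom)
    infer_instance
  haveI : IsIntegral (openSubschemeOver X'o U).left :=
    isIntegral_openSubschemeOver_of_mem (S := X'o) U h₁U
  obtain ⟨u₁, hu₁⟩ := exists_map_openSubschemeOverι_eq (X := X'o) U x₁ h₁U
  obtain ⟨u₀, hu₀⟩ := exists_map_openSubschemeOverι_eq (X := X'o) U x₀ h₀U
  have hu : u₁ ≠ u₀ := fun h => hx (by rw [← hu₁, ← hu₀, h])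
  -- the affine case inside `U`
  obtain ⟨C, g, a', b', hC, hirr, hsm, hdim, ha', hb'⟩ :=
    mumford_smoothCurve_through_two_points_holds.of_irreducibleSpace u₁ u₀ hu
  refine ⟨C, g ≫ openSubschemeOverι X'o U ≫ πo, a', b', hC, hirr, hsm, hdim, ?_, ?_⟩
  · rw [AlgPoints.map_comp_apply, AlgPoints.map_comp_apply, ha', hu₁, hx₁]
  · rw [AlgPoints.map_comp_apply, AlgPoints.map_comp_apply, hb', hu₀, hx₀]

/-- **Mumford's two-point lemma for irreducible varieties (separated form, no quasi-compactness).**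
For an integral separated `ℂ`-scheme `S` locally of finite type and complex points `a ≠ b`, there are a
smooth irreducible affine curve `C`, `g : C ⟶ S` and complex points `a'`, `b'` of `C` over `a`, `b`:
restrict to the quasi-compact open `U₁ ∪ U₀` for affine opens `U₁ ∋ a`, `U₀ ∋ b` and apply the
quasi-compact form. [cite: MumfordAV1970, §6, Lemma] [cite: GortzWedhorn2020, Thm. 13.100] -/
theorem mumford_smoothCurve_through_two_points_of_isSeparated {S : SchemeOver ℂ} [IsIntegral S.left]
    [IsSeparated S.hom] [LocallyOfFiniteType S.hom] (a b : ComplexPoints S) (hab : a ≠ b) :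
    ∃ (C : SchemeOver ℂ) (g : C ⟶ S) (a' b' : ComplexPoints C),
      IsAffine C.left ∧ IrreducibleSpace C.left ∧ AlgebraicGeometry.Smooth C.hom ∧
        topologicalKrullDim C.left = 1 ∧ AlgPoints.map g a' = a ∧ AlgPoints.map g b' = b := by
  obtain ⟨U₁, hU₁, ha₁, -⟩ := exists_isAffineOpen_mem_and_subset (U := ⊤) (x := a.pt) trivial
  obtain ⟨U₀, hU₀, hb₀, -⟩ := exists_isAffineOpen_mem_and_subset (U := ⊤) (x := b.pt) trivial
  let W : S.left.Opens := U₁ ⊔ U₀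
  have haW : a.pt ∈ W := TopologicalSpace.Opens.mem_sup.mpr (Or.inl ha₁)
  have hbW : b.pt ∈ W := TopologicalSpace.Opens.mem_sup.mpr (Or.inr hb₀)
  haveI : IsIntegral (openSubschemeOver S W).left := isIntegral_openSubschemeOver_of_mem W haW
  have hWc : IsCompact (W : Set S.left) := by
    change IsCompact ((U₁ ⊔ U₀ : S.left.Opens) : Set S.left)
    rw [TopologicalSpace.Opens.coe_sup]
    exact hU₁.isCompact.union hU₀.isCompact
  haveI : CompactSpace (W : Scheme) := isCompact_iff_compactSpace.mp hWc
  haveI : LocallyOfFiniteType (openSubschemeOver S W).hom := by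
    change LocallyOfFiniteType (W.ι ≫ S.hom)
    infer_instance
  haveI : IsSeparated (openSubschemeOver S W).hom := by
    change IsSeparated (W.ι ≫ S.hom)
    infer_instance
  haveI : QuasiCompact (openSubschemeOver S W).hom := by
    change QuasiCompact (W.ι ≫ S.hom)
    infer_instance
  obtain ⟨w₁, hw₁⟩ := exists_map_openSubschemeOverι_eq (X := S) W a haW
  obtain ⟨w₀, hw₀⟩ := exists_map_openSubschemeOverι_eq (X := S) W b hbW
  have hw : w₁ ≠ w₀ := fun h => hab (by rw [← hw₁, ← hw₀, h])
  obtain ⟨C, g, a', b', hC, hirr, hsm, hdim, ha', hb'⟩ :=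
    mumford_smoothCurve_through_two_points_of_isSeparated_of_quasiCompact w₁ w₀ hw
  refine ⟨C, g ≫ openSubschemeOverι S W, a', b', hC, hirr, hsm, hdim, ?_, ?_⟩
  · rw [AlgPoints.map_comp_apply, ha', hw₁]
  · rw [AlgPoints.map_comp_apply, hb', hw₀]

/-- **Mumford's two-point lemma over a smooth irreducible separated base** — the form consumed by
base-change arguments: for a SMOOTH irreducible separated `ℂ`-scheme `S` (smooth over a field ⇒ reduced,
`isReduced_of_smooth_over_field`, hence integral; smooth ⇒ locally of finite type) and complex points
`a ≠ b`, a smooth irreducible affine curve maps to `S` through `a` and `b`. [cite: MumfordAV1970, §6, Lemma]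
[cite: GortzWedhorn2020, Thm. 13.100] -/
theorem mumford_smoothCurve_through_two_points_of_isSeparated_of_smooth {S : SchemeOver ℂ}
    [IrreducibleSpace S.left] [AlgebraicGeometry.Smooth S.hom] [IsSeparated S.hom]
    (a b : ComplexPoints S) (hab : a ≠ b) :
    ∃ (C : SchemeOver ℂ) (g : C ⟶ S) (a' b' : ComplexPoints C),
      IsAffine C.left ∧ IrreducibleSpace C.left ∧ AlgebraicGeometry.Smooth C.hom ∧
        topologicalKrullDim C.left = 1 ∧ AlgPoints.map g a' = a ∧ AlgPoints.map g b' = b := by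
  haveI : IsReduced S.left := isReduced_of_smooth_over_field S.hom
  haveI : IsIntegral S.left := isIntegral_of_irreducibleSpace_of_isReduced S.left
  haveI : LocallyOfFiniteType S.hom := inferInstance
  exact mumford_smoothCurve_through_two_points_of_isSeparated a b hab

#print axioms Literature.AlgebraicGeometry.Motives.mumford_smoothCurve_through_two_points_of_isSeparated_of_smooth

end Literature.AlgebraicGeometry.Motives

end
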